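import Summits.QuantumFields.YangMills.Theorems.BalabanUVNodesN15PerCubeGreenTwoGridGradientNamedReg335HolderLetters
import Summits.QuantumFields.YangMills.Theorems.BalabanUVNodesN15PerCubeGreenTwoGridKnitDefectReg335Small
import HarnessLib

/-!
# N15 = NE2, road (c) — PROGRAMME (PC), (PC-E-J-N) 391J: THE GRADIENT ENTRY `D_U∘G′(U)` OF THE NAMED SCALAR COVARIANT GREEN's FUNCTIONS FROM ONE `Reg335HolderCube` DATUM PER CUBE
# AND ONE SMALLNESS CONDITION — n15-c∕391 with `D∘` in front: the threshold DISCHARGED by the real-algebra lemma `gradient_letters_bookkeeping` (n15-c∕355 `letters_bookkeeping` + the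
# transporter pairing-fit letter) on top of n15-c∕418; `∃ δ w₀ c₀ D`, majorant `D·((L^k)^{−1∕4} + o_B)·e^{−(δ∕16)|y−y′|_T}`, and the `_explicit` edition at `o_B := o_B^{H,expl}`;
# NO `∃ u′` (dag-n15-c g36, n15-c∕419)

Cell `pub-ymgap`, seat `pub-ymgap-dag-n15-c` (generation g36; R134 (a) seat, strategy s1 «first missing estimate»; HUMAN RULING D-0062; chair R424 venue).
`bears_on: R4∕N15 · K3⁸ SpineGivenEndpointR13SepCoPHV (stmt-QuantumFields-27366)`; filed `--kind proof --supports stmt-QuantumFields-27366 --as helper` — COUNT-NEUTRAL.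
THREE theorems, 0 `def`, 0 `sorry`: `gradient_letters_bookkeeping` ([folklore] real arithmetic: n15-c∕355's (i) verbatim and (ii) with the extra summand `T_A`, constant doubled) and
`uN_idef_covD_scGreenOp_of_reg335Holder_small` ∕ `…_small_explicit` = n15-c∕391's two theorems with (i) the parent replaced by n15-c∕418 `uN_idef_covD_scGreenOp_of_reg335Holder_letters`
(direction `μ₀`), (ii) the conclusions stated for `D_{U′,μ₀} ∘ scGreenOp′ … U′` against `D_{U,μ₀} ∘ scGreenOp … U` (n15-c∕388), SAME majorant shape `D·((L^k)^{−1∕4} + o_B)·e^{−(δ∕16)d}`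
(the constant `D` is now `max(D,0)·2(1+A+B+K_B)`), (iii) `letters_bookkeeping` replaced by `gradient_letters_bookkeeping` (same 112 arguments).  HYPOTHESES = 391's VERBATIM.  Imports
BY NAME n15-c∕418 and n15-c∕355 `…KnitDefectReg335Small`; generator `tools/build_419.py`; nothing in the tree is modified, no landed name re-declared.

HONEST FRAMING ∕ LIMITS.  Bookkeeping over landed theorems (real algebra on the majorant only); MODEL two-grid setting (King tori, straight-holonomy pairing, one cube scale `ξ`); the
datum is the typed per-cube class as a HYPOTHESIS; nothing of [B9]∕[B11] asserted.  The SHAPE of the gradient entry of [B9] (3.42) ∕ Thm 3.14 for `G′`, NOT the printed theorem.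
NE2⁺ NOT PRINTED ∕ NOT proved; N15 of record untouched (DISCHARGED AS CONSUMED, p687738); K3⁸ OPEN; counts of record UNMOVED (typed 28∕28 · discharged 8∕27); one finite 𝕋⁴ at
fixed ε per index — NOT infinite volume, NOT OS on ℝ⁴, NOT a mass gap, NOT Clay.  Restate-immune (no Theses import).
-/




set_option autoImplicit false

noncomputable section

open scoped BigOperators Matrix Matrix.Norms.L2Operator
open Finset

namespace Summit.QuantumFields.YangMills.BalabanUVNodes.N15.Gluing

open Real
open Literature.MathematicalPhysics.QuantumFieldTheory.Balaban1983to89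
open Literature.MathematicalPhysics.QuantumFieldTheory.Balaban1983to89.B5Prop11Plancherel (Tor fine unitVec)
open Literature.MathematicalPhysics.QuantumFieldTheory.Balaban1983to89.B11SectG (BlockNorm HasMaj)
open Literature.MathematicalPhysics.QuantumFieldTheory.Balaban1983to89.T4EtaRateDefect (idef)
open Literature.MathematicalPhysics.QuantumFieldTheory.Balaban1983to89.B6UnitTorusCarrier (unitTorusGeo)
open Summit.QuantumFields.YangMills.BalabanUVNodes.N15.CurvedSpecies (Reg335HolderCube)
open Literature.MathematicalPhysics.QuantumFieldTheory.King1986 (aK aK_pos aK_le)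
open Literature.MathematicalPhysics.QuantumFieldTheory.King1986.Torus (tdistT)
open Literature.MathematicalPhysics.QuantumFieldTheory.Balaban1983to89.B7Prop10InLambdaRec (one_add_pow_sub_one_le)
open Literature.Barriers.QuantumFields (traceForm)
open Summit.QuantumFields.YangMills.BalabanUVNodes.N15.BackgroundLayer (tCoefA tCoefC)
open Summit.QuantumFields.YangMills.BalabanUVNodes.N15.VectorPiece (kingPr)
open Summit.QuantumFields.YangMills.BalabanUVNodes.N15.MatrixSpecies (coordMat basisConst basisConst_nonneg liftBlk liftMap covD)
open Summit.QuantumFields.YangMills.BalabanUVNodes.N15.CurvedSpecies (gaugePair)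
open Summit.QuantumFields.YangMills.BalabanUVNodes.N15.CovAvg (mprod kingSec ctauS)

section Bookkeeping

set_option maxHeartbeats 800000 in
/-- ★★ **THE BOOKKEEPING OF THE LETTERS FOR THE GRADIENT ENTRY** (pure real arithmetic over n15-c∕355 `letters_bookkeeping`, same binders): under the ONE smallness condition,
(i) n15-c∕414's threshold holds at the chosen `r_V` (= 355 (i) verbatim), and (ii) the rate of n15-c∕418 — 355's bracket PLUS the transporter pairing-fit letter `o_a = T_A` — is
`≤ max(D,0)·2(1 + A + B + K_B)·(L^{−k∕4} + o_B)` (`T_A ≥ 0` is dominated by the bracket, so the extra summand at most doubles 355 (ii)). [folklore] -/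
theorem gradient_letters_bookkeeping
    (I dd dd1 J JJ nr Lk Lr Lrm η' η κ sm t t₂ pf qf Ep P Qq P1 Q1 EP PC E3 X INNER TA TC KTH aKk aKrk ON RV E1 E2 E4 x14 L2inv oB a₀ R₀ K₁ K₂ c₀ KI Aη Bc KB D ex : ℝ)
    (Nr M1 M2 M4 : ℕ)
    (hI0 : 0 ≤ I) (hdd0 : 0 ≤ dd) (hdd1 : dd1 = dd + 1) (hJ : J = dd + 1) (hJJ : JJ = 2 * (dd + 1)) (ha₀ : 0 < a₀)
    (hK₁ : K₁ = I * (6 + (dd + 1) * (36 * I + 6))) (hK₂ : K₂ = (1 + 2 * (dd + 1)) + 2 * a₀ * I * (4 * (dd + 1) ^ 2 * I + 4 * (dd + 1)))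
    (hc₀pos : 0 < c₀) (hc₀a : c₀ ≤ 1 / (100 * (dd + 1) * (I + 1) * (K₁ + 1))) (hc₀b : c₀ ≤ R₀ / (K₁ * K₂ + 1))
    (hKI : KI = (3 * (dd + 2) + 72 * I) * c₀)
    (hAη : Aη = (I * KI + I ^ 2 * (dd + 1) * KI) * (1 + 2 * (dd + 1)) + 2 * a₀ * I ^ 2 * ((dd + 1) * (3 * dd + 6) * c₀) + 12 * (dd + 1) * I * c₀)
    (hBc : Bc = 2 * a₀ * I * (1 + I)) (hKB : KB = I * (dd + 1) * (1 + 2 * (dd + 1)))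
    (hLk1 : 1 ≤ Lk) (hLr1 : 1 ≤ Lr) (hnrdef : nr = Lr * Lk) (hLrmdef : Lrm = Lr - 1) (hηqdef : η' = nr⁻¹) (hηdef : η = Lk⁻¹)
    (hNr : (Nr : ℝ) = Lr) (hM1 : (M1 : ℝ) = (dd + 1) * Lk) (hM2 : (M2 : ℝ) = (dd + 1) * nr) (hM4 : (M4 : ℝ) = (dd + 1) * Lrm)
    (hκ : 0 ≤ κ) (hsm : 0 ≤ sm) (ht0 : 0 ≤ t) (ht₂0 : 0 ≤ t₂) (hsmall : (1 + κ * sm) ^ 2 * (t + t₂) ≤ c₀)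
    (hpfdef : pf = t * Real.exp (η' * t)) (hqfdef : qf = t₂ * Real.exp (η' * t))
    (hEpdef : Ep = (1 + η' * pf) ^ Nr - 1) (hPdef : P = Ep / η) (hQqdef : Qq = qf * (1 + η' * pf) ^ Nr)
    (hP1def : P1 = κ * (sm * P)) (hQ1def : Q1 = κ * (sm * Qq)) (hEPdef : EP = (1 + η' * P) ^ Nr - 1) (hPCdef : PC = Lk * (κ * (sm * EP)))
    (hE3def : E3 = (1 + I * (η' * P1)) ^ Nr - 1) (hXdef : X = dd1 * Lrm + Lr + 1)
    (hINNERdef : INNER = nr * (κ * (sm * (X * (η' ^ 2 * qf))) + E3 * (η' * P1))) (hTAdef : TA = I * INNER) (hTCdef : TC = I * (J * (oB + I * (INNER * (P1 + PC)))))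
    (hKTHdef : KTH = κ * (sm * ((dd + 1) * (dd * (nr * (Lr * (η' ^ 2 * qf))) + Ep))))
    (haK : |aKk| ≤ a₀) (hΔaK : |aKrk - aKk| ≤ 2 * a₀ * L2inv)
    (hONdef : ON = I * (|aKrk - aKk| * (1 + I) + |aKk| * (2 * I * KTH)))
    (hRVdef : RV = I * P1 + I * (J * (I * P1 ^ 2 + Q1))) (hE1def : E1 = (1 + RV * η) ^ M1 - 1) (hE2def : E2 = (1 + RV * η') ^ M2 - 1)
    (hE4def : E4 = (1 + (I * (η' * P1))) ^ M4 - 1) (hx0 : 0 ≤ x14) (hηx : η ≤ x14) (hL2x : L2inv ≤ x14) (hoB : 0 ≤ oB) (hex : 0 < ex) :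
    RV * (1 + JJ) + (a₀ * (I * (I * E1 ^ 2 + 2 * E1)) + a₀ * (I * (I * E2 ^ 2 + 2 * E2))) ≤ R₀ ∧
      D * (x14 + ((TA + TC) * (1 + JJ) + ON + E4) + TA) * ex ≤ max D 0 * (2 * (1 + Aη + Bc + KB)) * (x14 + oB) * ex := by
  obtain ⟨h1, h2⟩ := letters_bookkeeping I dd dd1 J JJ nr Lk Lr Lrm η' η κ sm t t₂ pf qf Ep P Qq P1 Q1 EP PC E3 X INNER TA TC KTH aKk aKrk ON RV E1 E2 E4 x14 L2inv oB a₀ R₀ K₁ K₂ c₀ KI Aη Bc KB 1 ex Nr M1 M2 M4 hI0 hdd0 hdd1 hJ hJJ ha₀ hK₁ hK₂ hc₀pos hc₀a hc₀b hKI hAη hBc hKB hLk1 hLr1 hnrdef hLrmdef hηqdef hηdef hNr hM1 hM2 hM4 hκ hsm ht0 ht₂0 hsmall hpfdef hqfdef hEpdef hPdef hQqdef hP1def hQ1def hEPdef hPCdef hE3def hXdef hINNERdef hTAdef hTCdef hKTHdef haK hΔaK hONdef hRVdef hE1def hE2def hE4def hx0 hηx hL2x hoB hex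
  refine ⟨h1, ?_⟩
  obtain ⟨hLk0, hLr0⟩ : 0 < Lk ∧ 0 < Lr := ⟨by linarith only [hLk1], by linarith only [hLr1]⟩
  have hnr0 : 0 ≤ nr := by rw [hnrdef]; positivity
  have hη0 : 0 ≤ η := by rw [hηdef]; positivity
  have hη'0 : 0 ≤ η' := by rw [hηqdef]; positivity
  have hpf0 : 0 ≤ pf := by rw [hpfdef]; positivity
  have hqf0 : 0 ≤ qf := by rw [hqfdef]; positivity
  have hEp0 : 0 ≤ Ep := by
    have := one_le_pow₀ (M₀ := ℝ) (a := 1 + η' * pf) (le_add_of_nonneg_right (by positivity)) (n := Nr); rw [hEpdef]; linarith only [this]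
  have hP0 : 0 ≤ P := by rw [hPdef]; positivity
  have hP10 : 0 ≤ P1 := by rw [hP1def]; positivity
  have hEP0 : 0 ≤ EP := by
    have := one_le_pow₀ (M₀ := ℝ) (a := 1 + η' * P) (le_add_of_nonneg_right (by positivity)) (n := Nr); rw [hEPdef]; linarith only [this]
  have hPC0 : 0 ≤ PC := by rw [hPCdef]; positivity
  have hE30 : 0 ≤ E3 := by
    have := one_le_pow₀ (M₀ := ℝ) (a := 1 + I * (η' * P1)) (le_add_of_nonneg_right (by positivity)) (n := Nr); rw [hE3def]; linarith only [this]
  have hLrm0 : 0 ≤ Lrm := by rw [hLrmdef]; linarith only [hLr1]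
  have hX0 : 0 ≤ X := by rw [hXdef, hdd1]; positivity
  have hINNER0 : 0 ≤ INNER := by rw [hINNERdef]; positivity
  have hKTH0 : 0 ≤ KTH := by rw [hKTHdef]; positivity
  obtain ⟨hTA0, hTC0, hON0⟩ : 0 ≤ TA ∧ 0 ≤ TC ∧ 0 ≤ ON := ⟨by rw [hTAdef]; positivity, by rw [hTCdef, hJ]; positivity, by rw [hONdef]; positivity⟩
  have hE40 : 0 ≤ E4 := by
    have := one_le_pow₀ (M₀ := ℝ) (a := 1 + I * (η' * P1)) (le_add_of_nonneg_right (by positivity)) (n := M4); rw [hE4def]; linarith only [this]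
  have hJJ0 : 0 ≤ JJ := by rw [hJJ]; positivity
  have hKI0 : 0 ≤ KI := by rw [hKI]; positivity
  have hK0 : 0 ≤ 1 + Aη + Bc + KB := by rw [hAη, hBc, hKB]; positivity
  have hBR : TA ≤ (TA + TC) * (1 + JJ) + ON + E4 := by nlinarith only [hTA0, hTC0, hON0, hE40, hJJ0]
  have hS0 : 0 ≤ x14 + ((TA + TC) * (1 + JJ) + ON + E4) := by linarith only [hx0, hTA0, hBR]
  have h2' : (x14 + ((TA + TC) * (1 + JJ) + ON + E4)) * ex ≤ (1 + Aη + Bc + KB) * (x14 + oB) * ex := by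
    have h := h2; rw [max_eq_left (zero_le_one : (0 : ℝ) ≤ 1)] at h; linarith only [h]
  calc D * (x14 + ((TA + TC) * (1 + JJ) + ON + E4) + TA) * ex
      ≤ max D 0 * (x14 + ((TA + TC) * (1 + JJ) + ON + E4) + TA) * ex :=
        mul_le_mul_of_nonneg_right (mul_le_mul_of_nonneg_right (le_max_left _ _) (by linarith only [hS0, hTA0])) hex.le
    _ ≤ max D 0 * (2 * (x14 + ((TA + TC) * (1 + JJ) + ON + E4))) * ex :=
        mul_le_mul_of_nonneg_right (mul_le_mul_of_nonneg_left (by linarith only [hBR, hx0]) (le_max_right _ _)) hex.le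
    _ = 2 * max D 0 * ((x14 + ((TA + TC) * (1 + JJ) + ON + E4)) * ex) := by ring
    _ ≤ 2 * max D 0 * ((1 + Aη + Bc + KB) * (x14 + oB) * ex) := mul_le_mul_of_nonneg_left h2' (by positivity)
    _ = max D 0 * (2 * (1 + Aη + Bc + KB)) * (x14 + oB) * ex := by ring

end Bookkeeping

variable {d : ℕ}

section Small

variable {L : ℕ} [NeZero L]
set_option maxHeartbeats 3200000 in
/-- ★★★ n15-c∕391 for THE GRADIENT ENTRY `D_U∘G′(U)` of the named scalar covariant Green's functions: ONE `Reg335HolderCube` datum per cube + ONE smallness condition ⟹ the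
two-grid η-defect through `τ_{Ad∘U′}` of `D_{U′,μ₀}∘scGreenOp′ U′` against `D_{U,μ₀}∘scGreenOp U` is `≤ D·((L^k)^{−1∕4} + o_B)·e^{−(δ∕16)|y−y′|_T}` (NO `∃ u′`).  See the module docstring.
[cite: Balaban1985BackgroundPropagators, (3.42) p.397, Thm 3.14 pp.426–427 (template), (3.24)–(3.25) p.394, (3.35) p.396, (3.51)–(3.52) p.400 (shapes); Balaban1985Variational, Thm 1 (9) p.279 (shape); King1986, p.664 (pairing)] -/
theorem uN_idef_covD_scGreenOp_of_reg335Holder_small (hL : Odd L ∧ 1 < L) (hL7 : 7 ≤ L) {a₀ : ℝ} (ha₀ : 0 < a₀) (ι : Type) [Fintype ι] [DecidableEq ι] (μ₀ : Fin (d + 1)) :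
    ∃ δ w₀ c₀ D : ℝ, 0 < δ ∧ 0 < c₀ ∧ ∀ (mv kk r : ℕ), 1 ≤ kk → 1 ≤ r → w₀ ≤ ((L ^ mv : ℕ) : ℝ) →
      ∀ {mm : Type} [Fintype mm] [DecidableEq mm] [Nonempty mm] (e : Matrix mm mm ℂ ≃L[ℝ] (ι → ℝ)), (∀ A B : Matrix mm mm ℂ, traceForm A B = e A ⬝ᵥ e B) →
      ∀ (U' : Fin (d + 1) → ScX' d L mv kk r hL → (Matrix mm mm ℂ)ˣ), (∀ μ x', (U' μ x' : Matrix mm mm ℂ) ∈ Matrix.unitaryGroup mm ℂ) →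
      ∀ (Q : (Fin (d + 1) → ZMod (2 * L)) → Set (ScX' d L mv kk r hL)) (ξ C β Cβ : ℝ), 0 < ξ → 0 ≤ C → 0 ≤ β → 0 ≤ Cβ →
        (1 + @basisConst ι _ (Matrix mm mm ℂ) Matrix.frobeniusNormedAddCommGroup Matrix.frobeniusNormedSpace e * (2 * Real.sqrt (Fintype.card mm)) * Real.sqrt (Fintype.card mm)) ^ 2 * (C / ξ + C / ξ ^ 2) ≤ c₀ →
        (∀ k, Reg335HolderCube (scShift' d L mv kk r hL) U' ((((L ^ r * L ^ kk : ℕ) : ℝ))⁻¹) (Q k) ξ (fun z z' => ((((L ^ r * L ^ kk : ℕ) : ℝ))⁻¹) * tdistT (fine (L ^ r * L ^ kk) (cvM d L mv kk hL)) z z') C β Cβ) →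
        (∀ k z, (∃ y ∈ cvSk d L mv kk hL k, (unitTorusGeo L kk (cvM d L mv kk hL)).dist (scBlk' d L mv kk r hL z) y ≤ 5) → z ∈ Q k) →
      ∀ (oB : ℝ), 0 ≤ oB →
        (@basisConst ι _ (Matrix mm mm ℂ) Matrix.frobeniusNormedAddCommGroup Matrix.frobeniusNormedSpace e * (((L ^ r * L ^ kk : ℕ) : ℝ) ^ 2 * (Fintype.card mm * (2 * (((((L ^ r * L ^ kk : ℕ) : ℝ))⁻¹) ^ 2 * ((Cβ * (ξ ^ (2 + β))⁻¹ * (2 * ((L ^ r : ℕ) : ℝ) * ((((L ^ r * L ^ kk : ℕ) : ℝ))⁻¹)) ^ β + 2 * ((((L ^ r * L ^ kk : ℕ) : ℝ))⁻¹) * ((C / ξ) * (C / ξ ^ 2))) * Real.exp (5 * (((((L ^ r * L ^ kk : ℕ) : ℝ))⁻¹) * (C / ξ))))) + ((((L ^ r * L ^ kk : ℕ) : ℝ))⁻¹) ^ 2 * ((C / ξ ^ 2) * Real.exp (((((L ^ r * L ^ kk : ℕ) : ℝ))⁻¹) * (C / ξ))) * (((d + 1 : ℕ) : ℝ) * (((L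 ^ r - 1 : ℕ) : ℝ) * (((((L ^ r * L ^ kk : ℕ) : ℝ))⁻¹) ^ 2 * ((C / ξ ^ 2) * Real.exp (((((L ^ r * L ^ kk : ℕ) : ℝ))⁻¹) * (C / ξ)))))) + (((((L ^ r * L ^ kk : ℕ) : ℝ))⁻¹) ^ 2 * ((C / ξ ^ 2) * Real.exp (((((L ^ r * L ^ kk : ℕ) : ℝ))⁻¹) * (C / ξ))) + (((d + 1 : ℕ) : ℝ) * (((L ^ r - 1 : ℕ) : ℝ) * (((((L ^ r * L ^ kk : ℕ) : ℝ))⁻¹) ^ 2 * ((C / ξ ^ 2) * Real.exp (((((L ^ r * L ^ kk : ℕ) : ℝ))⁻¹) * (C / ξ)))))) + ((((L ^ r * L ^ kk : ℕ) : ℝ))⁻¹) ^ 2 * ((C / ξ ^ 2) * Real.exp (((((L ^ r * L ^ kk : ℕ) : ℝ))⁻¹) * (C / ξ)))) * (((((L ^ r * L ^ kk : ℕ) : ℝ))⁻¹) ^ 2 * ((C / ξ ^ 2) * Real.exp (((((L ^ r * L ^ kk : ℕ) : ℝ))⁻¹) * (C / ξ)))))) + Fintype.card mm * (2 * ((L ^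 kk : ℕ) : ℝ) ^ 2 * (2 * ((L ^ r : ℕ) : ℝ) ^ 3 * ((((((L ^ r * L ^ kk : ℕ) : ℝ))⁻¹) * ((C / ξ) * Real.exp (((((L ^ r * L ^ kk : ℕ) : ℝ))⁻¹) * (C / ξ)))) * (((((L ^ r * L ^ kk : ℕ) : ℝ))⁻¹) ^ 2 * ((C / ξ ^ 2) * Real.exp (((((L ^ r * L ^ kk : ℕ) : ℝ))⁻¹) * (C / ξ))))) + ((L ^ r : ℕ) : ℝ) ^ 2 * (((((L ^ r * L ^ kk : ℕ) : ℝ))⁻¹) ^ 2 * ((Cβ * (ξ ^ (2 + β))⁻¹ * (2 * ((L ^ r : ℕ) : ℝ) * ((((L ^ r * L ^ kk : ℕ) : ℝ))⁻¹)) ^ β + 2 * ((((L ^ r * L ^ kk : ℕ) : ℝ))⁻¹) * ((C / ξ) * (C / ξ ^ 2))) * Real.exp (5 * (((((L ^ r * L ^ kk : ℕ) : ℝ))⁻¹) * (C / ξ)))))) + 2 * (((L ^ r : ℕ) : ℝ) * ((L ^ kk : ℕ) : ℝ)) ^ 2 * ((((L ^ r : ℕ) : ℝ) + 1) * (((((L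 ^ r * L ^ kk : ℕ) : ℝ))⁻¹) * ((C / ξ) * Real.exp (((((L ^ r * L ^ kk : ℕ) : ℝ))⁻¹) * (C / ξ)))) * (((((L ^ r * L ^ kk : ℕ) : ℝ))⁻¹) ^ 2 * ((C / ξ ^ 2) * Real.exp (((((L ^ r * L ^ kk : ℕ) : ℝ))⁻¹) * (C / ξ)))))))) ≤ oB →
        HasMaj (ScNorm d L mv kk hL ι) (BlockNorm.ofBlocks (unitTorusGeo L kk (cvM d L mv kk hL)) (liftBlk (scBlk d L mv kk hL ∘ kingPr L kk r (cvM d L mv kk hL)) ι))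
          (idef (ctauS (cvM d L mv kk hL) L kk r (fun μ x' => coordMat e (ContinuousLinearMap.mulLeftRight ℝ (Matrix mm mm ℂ) ((U' μ x' : Matrix mm mm ℂ)) ((U' μ x' : Matrix mm mm ℂ))ᴴ))) (ctauS (cvM d L mv kk hL) L kk r (fun μ x' => coordMat e (ContinuousLinearMap.mulLeftRight ℝ (Matrix mm mm ℂ) ((U' μ x' : Matrix mm mm ℂ)) ((U' μ x' : Matrix mm mm ℂ))ᴴ))) (covD ((((L ^ r * L ^ kk : ℕ) : ℝ))⁻¹) (fun x' => coordMat e (ContinuousLinearMap.mulLeftRight ℝ (Matrix mm mm ℂ) ((U' μ₀ x' : Matrix mm mm ℂ)) ((U' μ₀ x' : Matrix mm mm ℂ))ᴴ)) (scShift' d L mv kk r hL μ₀) ∘ₗ scGreenOp' d L mv kk r hL (aK a₀ (L : ℝ) (r + kk) * (((L ^ r * L ^ kk : ℕ) : ℝ)) ^ (d + 1)) ((((L ^ r * L ^ kk : ℕ) : ℝ))⁻¹) ι e (fun μ z => (U' μ z : Matrix mm mm ℂ))) (covD ((((L ^ kk : ℕ) : ℝ))⁻¹) (fun x => coordMat e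 (ContinuousLinearMap.mulLeftRight ℝ (Matrix mm mm ℂ) ((fun μ y => mprod (fun t => (U' μ (kingSec (cvM d L mv kk hL) L kk r y + t • unitVec (fine (L ^ r * L ^ kk) (cvM d L mv kk hL)) μ) : Matrix mm mm ℂ)) (L ^ r)) μ₀ x) ((fun μ y => mprod (fun t => (U' μ (kingSec (cvM d L mv kk hL) L kk r y + t • unitVec (fine (L ^ r * L ^ kk) (cvM d L mv kk hL)) μ) : Matrix mm mm ℂ)) (L ^ r)) μ₀ x)ᴴ)) (scShift d L mv kk hL μ₀) ∘ₗ scGreenOp d L mv kk hL (aK a₀ (L : ℝ) kk * (((L ^ kk : ℕ) : ℝ)) ^ (d + 1)) ((((L ^ kk : ℕ) : ℝ))⁻¹) ι e (fun μ y => mprod (fun t => (U' μ (kingSec (cvM d L mv kk hL) L kk r y + t • unitVec (fine (L ^ r * L ^ kk) (cvM d L mv kk hL)) μ) : Matrix mm mm ℂ)) (L ^ r))))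
          (fun y y' => D * (((L : ℝ) ^ kk) ^ (-(1 / 4 : ℝ)) + oB) * Real.exp (-(δ / 16 * (unitTorusGeo L kk (cvM d L mv kk hL)).dist y y'))) := by
  obtain ⟨δ, w₀, R₀, D, hδ, hR₀, H⟩ := uN_idef_covD_scGreenOp_of_reg335Holder_letters (d := d) hL hL7 ha₀ ι μ₀
  have hLpos : 0 < L := (by have := hL.2; omega)
  have hL1r : (1 : ℝ) < (L : ℝ) := by exact_mod_cast hL.2
  have hL2r : (2 : ℝ) ≤ (L : ℝ) := by exact_mod_cast (show 2 ≤ L by have := hL.2; omega)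
  have hI0 : (0 : ℝ) ≤ (Fintype.card ι : ℝ) := Nat.cast_nonneg _
  have hdd0 : (0 : ℝ) ≤ (d : ℝ) := Nat.cast_nonneg _
  obtain ⟨K₁, hK₁⟩ : ∃ K₁ : ℝ, K₁ = (Fintype.card ι : ℝ) * (6 + ((d : ℝ) + 1) * (36 * (Fintype.card ι : ℝ) + 6)) := ⟨_, rfl⟩
  obtain ⟨K₂, hK₂⟩ : ∃ K₂ : ℝ, K₂ = (1 + 2 * ((d : ℝ) + 1)) + 2 * a₀ * (Fintype.card ι : ℝ) * (4 * ((d : ℝ) + 1) ^ 2 * (Fintype.card ι : ℝ) + 4 * ((d : ℝ) + 1)) := ⟨_, rfl⟩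
  obtain ⟨hK₁0, hK₂0⟩ : 0 ≤ K₁ ∧ 0 ≤ K₂ := ⟨by rw [hK₁]; positivity, by rw [hK₂]; positivity⟩
  obtain ⟨c₀, hc₀⟩ : ∃ c₀ : ℝ, c₀ = min (1 / (100 * ((d : ℝ) + 1) * ((Fintype.card ι : ℝ) + 1) * (K₁ + 1))) (R₀ / (K₁ * K₂ + 1)) := ⟨_, rfl⟩
  have hc₀pos : 0 < c₀ := by rw [hc₀]; exact lt_min (by positivity) (by positivity)
  have hc₀a : c₀ ≤ 1 / (100 * ((d : ℝ) + 1) * ((Fintype.card ι : ℝ) + 1) * (K₁ + 1)) := by rw [hc₀]; exact min_le_left _ _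
  have hc₀b : c₀ ≤ R₀ / (K₁ * K₂ + 1) := by rw [hc₀]; exact min_le_right _ _
  obtain ⟨KI, hKI⟩ : ∃ KI : ℝ, KI = (3 * ((d : ℝ) + 2) + 72 * (Fintype.card ι : ℝ)) * c₀ := ⟨_, rfl⟩
  obtain ⟨Aη, hAη⟩ : ∃ Aη : ℝ, Aη = ((Fintype.card ι : ℝ) * KI + (Fintype.card ι : ℝ) ^ 2 * ((d : ℝ) + 1) * KI) * (1 + 2 * ((d : ℝ) + 1)) +
      2 * a₀ * (Fintype.card ι : ℝ) ^ 2 * (((d : ℝ) + 1) * (3 * (d : ℝ) + 6) * c₀) + 12 * ((d : ℝ) + 1) * (Fintype.card ι : ℝ) * c₀ := ⟨_, rfl⟩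
  obtain ⟨Bc, hBc⟩ : ∃ Bc : ℝ, Bc = 2 * a₀ * (Fintype.card ι : ℝ) * (1 + (Fintype.card ι : ℝ)) := ⟨_, rfl⟩
  obtain ⟨KB, hKB⟩ : ∃ KB : ℝ, KB = (Fintype.card ι : ℝ) * ((d : ℝ) + 1) * (1 + 2 * ((d : ℝ) + 1)) := ⟨_, rfl⟩
  refine ⟨δ, w₀, c₀, max D 0 * (2 * (1 + Aη + Bc + KB)), hδ, hc₀pos, fun mv kk r hk hr hw₀ => ?_⟩
  intro mm _ _ _ e he U' hU'g Q ξ C β Cβ hξ hC hβ hCβ hsmall h335 hQ oB hoB hBle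
  have H1 := H mv kk r hk hr hw₀ e he U' hU'g Q ξ C β Cβ hξ hC hβ hCβ h335 hQ oB hoB hBle
  clear H
  have hκ := @basisConst_nonneg ι _ (Matrix mm mm ℂ) Matrix.frobeniusNormedAddCommGroup Matrix.frobeniusNormedSpace e
  have hx1 : (1 : ℝ) ≤ (L : ℝ) ^ kk := one_le_pow₀ hL1r.le
  have hLk1 : (1 : ℝ) ≤ (((L ^ kk : ℕ) : ℝ)) := by exact_mod_cast Nat.one_le_pow _ _ hLpos
  have hLr1 : (1 : ℝ) ≤ ((L ^ r : ℕ) : ℝ) := by exact_mod_cast Nat.one_le_pow _ _ hLpos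
  have key := fun (y y' : Tor (cvM d L mv kk hL)) => gradient_letters_bookkeeping ((Fintype.card ι : ℝ)) ((d : ℝ)) (((d + 1 : ℕ) : ℝ)) ((Fintype.card (Fin (d + 1)) : ℝ)) ((Fintype.card (Fin (d + 1) ⊕ Fin (d + 1)) : ℝ)) ((((L ^ r * L ^ kk : ℕ) : ℝ))) ((((L ^ kk : ℕ) : ℝ))) (((L ^ r : ℕ) : ℝ)) (((L ^ r - 1 : ℕ) : ℝ)) (((((L ^ r * L ^ kk : ℕ) : ℝ))⁻¹)) (((((L ^ kk : ℕ) : ℝ))⁻¹)) (@basisConst ι _ (Matrix mm mm ℂ) Matrix.frobeniusNormedAddCommGroup Matrix.frobeniusNormedSpace e * (2 * Real.sqrt (Fintype.card mm))) (Real.sqrt (Fintype.card mm)) ((C / ξ)) ((C / ξ ^ 2)) (((C / ξ) * Real.exp (((((L ^ r * L ^ kk : ℕ) : ℝ))⁻¹) * (C / ξ)))) (((C / ξ ^ 2) * Real.exp (((((L ^ r * L ^ kk : ℕ) : ℝ))⁻¹) * (C / ξ)))) (((1 + ((((L ^ r * L ^ kk : ℕ) : ℝ))⁻¹) * ((C /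 ξ) * Real.exp (((((L ^ r * L ^ kk : ℕ) : ℝ))⁻¹) * (C / ξ)))) ^ (L ^ r) - 1)) ((((1 + ((((L ^ r * L ^ kk : ℕ) : ℝ))⁻¹) * ((C / ξ) * Real.exp (((((L ^ r * L ^ kk : ℕ) : ℝ))⁻¹) * (C / ξ)))) ^ (L ^ r) - 1) / ((((L ^ kk : ℕ) : ℝ))⁻¹))) ((((C / ξ ^ 2) * Real.exp (((((L ^ r * L ^ kk : ℕ) : ℝ))⁻¹) * (C / ξ))) * (1 + ((((L ^ r * L ^ kk : ℕ) : ℝ))⁻¹) * ((C / ξ) * Real.exp (((((L ^ r * L ^ kk : ℕ) : ℝ))⁻¹) * (C / ξ)))) ^ (L ^ r))) ((@basisConst ι _ (Matrix mm mm ℂ) Matrix.frobeniusNormedAddCommGroup Matrix.frobeniusNormedSpace e * (2 * Real.sqrt (Fintype.card mm)) * (Real.sqrt (Fintype.card mm) * (((1 + ((((L ^ r * L ^ kk : ℕ) : ℝ))⁻¹) * ((C / ξ) * Real.exp (((((L ^ r * L ^ kk : ℕ) : ℝ))⁻¹) * (C / ξ)))) ^ (L ^ r) - 1) / ((((L ^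 kk : ℕ) : ℝ))⁻¹))))) ((@basisConst ι _ (Matrix mm mm ℂ) Matrix.frobeniusNormedAddCommGroup Matrix.frobeniusNormedSpace e * (2 * Real.sqrt (Fintype.card mm)) * (Real.sqrt (Fintype.card mm) * (((C / ξ ^ 2) * Real.exp (((((L ^ r * L ^ kk : ℕ) : ℝ))⁻¹) * (C / ξ))) * (1 + ((((L ^ r * L ^ kk : ℕ) : ℝ))⁻¹) * ((C / ξ) * Real.exp (((((L ^ r * L ^ kk : ℕ) : ℝ))⁻¹) * (C / ξ)))) ^ (L ^ r))))) (((1 + ((((L ^ r * L ^ kk : ℕ) : ℝ))⁻¹) * (((1 + ((((L ^ r * L ^ kk : ℕ) : ℝ))⁻¹) * ((C / ξ) * Real.exp (((((L ^ r * L ^ kk : ℕ) : ℝ))⁻¹) * (C / ξ)))) ^ (L ^ r) - 1) / ((((L ^ kk : ℕ) : ℝ))⁻¹))) ^ (L ^ r) - 1)) (((((L ^ kk : ℕ) : ℝ)) * (@basisConst ι _ (Matrix mm mm ℂ) Matrix.frobeniusNormedAddCommGroup Matrix.frobeniusNormedSpace e * (2 * Real.sqrt (Fintype.card mm)) * (Real.sqrt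 (Fintype.card mm) * ((1 + ((((L ^ r * L ^ kk : ℕ) : ℝ))⁻¹) * (((1 + ((((L ^ r * L ^ kk : ℕ) : ℝ))⁻¹) * ((C / ξ) * Real.exp (((((L ^ r * L ^ kk : ℕ) : ℝ))⁻¹) * (C / ξ)))) ^ (L ^ r) - 1) / ((((L ^ kk : ℕ) : ℝ))⁻¹))) ^ (L ^ r) - 1))))) (((1 + Fintype.card ι * (((((L ^ r * L ^ kk : ℕ) : ℝ))⁻¹) * (@basisConst ι _ (Matrix mm mm ℂ) Matrix.frobeniusNormedAddCommGroup Matrix.frobeniusNormedSpace e * (2 * Real.sqrt (Fintype.card mm)) * (Real.sqrt (Fintype.card mm) * (((1 + ((((L ^ r * L ^ kk : ℕ) : ℝ))⁻¹) * ((C / ξ) * Real.exp (((((L ^ r * L ^ kk : ℕ) : ℝ))⁻¹) * (C / ξ)))) ^ (L ^ r) - 1) / ((((L ^ kk : ℕ) : ℝ))⁻¹)))))) ^ (L ^ r) - 1)) (((((d + 1 : ℕ) : ℝ) * ((L ^ r - 1 : ℕ) : ℝ) + (L ^ r : ℕ) + 1))) ((((L ^ r * L ^ kk : ℕ) : ℝ)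 * (@basisConst ι _ (Matrix mm mm ℂ) Matrix.frobeniusNormedAddCommGroup Matrix.frobeniusNormedSpace e * (2 * Real.sqrt (Fintype.card mm)) * (Real.sqrt (Fintype.card mm) * ((((d + 1 : ℕ) : ℝ) * ((L ^ r - 1 : ℕ) : ℝ) + (L ^ r : ℕ) + 1) * (((((L ^ r * L ^ kk : ℕ) : ℝ))⁻¹) ^ 2 * ((C / ξ ^ 2) * Real.exp (((((L ^ r * L ^ kk : ℕ) : ℝ))⁻¹) * (C / ξ)))))) + ((1 + Fintype.card ι * (((((L ^ r * L ^ kk : ℕ) : ℝ))⁻¹) * (@basisConst ι _ (Matrix mm mm ℂ) Matrix.frobeniusNormedAddCommGroup Matrix.frobeniusNormedSpace e * (2 * Real.sqrt (Fintype.card mm)) * (Real.sqrt (Fintype.card mm) * (((1 + ((((L ^ r * L ^ kk : ℕ) : ℝ))⁻¹) * ((C / ξ) * Real.exp (((((L ^ r * L ^ kk : ℕ) : ℝ))⁻¹) * (C / ξ)))) ^ (L ^ r) - 1) / ((((L ^ kk : ℕ) : ℝ))⁻¹)))))) ^ (L ^ r) - 1) * (((((L ^ r * L ^ kk : ℕ)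 : ℝ))⁻¹) * (@basisConst ι _ (Matrix mm mm ℂ) Matrix.frobeniusNormedAddCommGroup Matrix.frobeniusNormedSpace e * (2 * Real.sqrt (Fintype.card mm)) * (Real.sqrt (Fintype.card mm) * (((1 + ((((L ^ r * L ^ kk : ℕ) : ℝ))⁻¹) * ((C / ξ) * Real.exp (((((L ^ r * L ^ kk : ℕ) : ℝ))⁻¹) * (C / ξ)))) ^ (L ^ r) - 1) / ((((L ^ kk : ℕ) : ℝ))⁻¹)))))))) (Fintype.card ι * (((L ^ r * L ^ kk : ℕ) : ℝ) * (@basisConst ι _ (Matrix mm mm ℂ) Matrix.frobeniusNormedAddCommGroup Matrix.frobeniusNormedSpace e * (2 * Real.sqrt (Fintype.card mm)) * (Real.sqrt (Fintype.card mm) * ((((d + 1 : ℕ) : ℝ) * ((L ^ r - 1 : ℕ) : ℝ) + (L ^ r : ℕ) + 1) * (((((L ^ r * L ^ kk : ℕ) : ℝ))⁻¹) ^ 2 * ((C / ξ ^ 2) * Real.exp (((((L ^ r * L ^ kk : ℕ) : ℝ))⁻¹) * (C / ξ)))))) + ((1 + Fintype.card ι * (((((L ^ r * L ^ kk : ℕ)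 : ℝ))⁻¹) * (@basisConst ι _ (Matrix mm mm ℂ) Matrix.frobeniusNormedAddCommGroup Matrix.frobeniusNormedSpace e * (2 * Real.sqrt (Fintype.card mm)) * (Real.sqrt (Fintype.card mm) * (((1 + ((((L ^ r * L ^ kk : ℕ) : ℝ))⁻¹) * ((C / ξ) * Real.exp (((((L ^ r * L ^ kk : ℕ) : ℝ))⁻¹) * (C / ξ)))) ^ (L ^ r) - 1) / ((((L ^ kk : ℕ) : ℝ))⁻¹)))))) ^ (L ^ r) - 1) * (((((L ^ r * L ^ kk : ℕ) : ℝ))⁻¹) * (@basisConst ι _ (Matrix mm mm ℂ) Matrix.frobeniusNormedAddCommGroup Matrix.frobeniusNormedSpace e * (2 * Real.sqrt (Fintype.card mm)) * (Real.sqrt (Fintype.card mm) * (((1 + ((((L ^ r * L ^ kk : ℕ) : ℝ))⁻¹) * ((C / ξ) * Real.exp (((((L ^ r * L ^ kk : ℕ) : ℝ))⁻¹) * (C / ξ)))) ^ (L ^ r) - 1) / ((((L ^ kk : ℕ) : ℝ))⁻¹)))))))) (Fintype.card ι * (Fintype.card (Fin (d + 1)) * (oB + Fintype.card ι * ((((L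 ^ r * L ^ kk : ℕ) : ℝ) * (@basisConst ι _ (Matrix mm mm ℂ) Matrix.frobeniusNormedAddCommGroup Matrix.frobeniusNormedSpace e * (2 * Real.sqrt (Fintype.card mm)) * (Real.sqrt (Fintype.card mm) * ((((d + 1 : ℕ) : ℝ) * ((L ^ r - 1 : ℕ) : ℝ) + (L ^ r : ℕ) + 1) * (((((L ^ r * L ^ kk : ℕ) : ℝ))⁻¹) ^ 2 * ((C / ξ ^ 2) * Real.exp (((((L ^ r * L ^ kk : ℕ) : ℝ))⁻¹) * (C / ξ)))))) + ((1 + Fintype.card ι * (((((L ^ r * L ^ kk : ℕ) : ℝ))⁻¹) * (@basisConst ι _ (Matrix mm mm ℂ) Matrix.frobeniusNormedAddCommGroup Matrix.frobeniusNormedSpace e * (2 * Real.sqrt (Fintype.card mm)) * (Real.sqrt (Fintype.card mm) * (((1 + ((((L ^ r * L ^ kk : ℕ) : ℝ))⁻¹) * ((C / ξ) * Real.exp (((((L ^ r * L ^ kk : ℕ) : ℝ))⁻¹) * (C / ξ)))) ^ (L ^ r) - 1) / ((((L ^ kk : ℕ) : ℝ))⁻¹)))))) ^ (L ^ r) - 1)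 * (((((L ^ r * L ^ kk : ℕ) : ℝ))⁻¹) * (@basisConst ι _ (Matrix mm mm ℂ) Matrix.frobeniusNormedAddCommGroup Matrix.frobeniusNormedSpace e * (2 * Real.sqrt (Fintype.card mm)) * (Real.sqrt (Fintype.card mm) * (((1 + ((((L ^ r * L ^ kk : ℕ) : ℝ))⁻¹) * ((C / ξ) * Real.exp (((((L ^ r * L ^ kk : ℕ) : ℝ))⁻¹) * (C / ξ)))) ^ (L ^ r) - 1) / ((((L ^ kk : ℕ) : ℝ))⁻¹))))))) * ((@basisConst ι _ (Matrix mm mm ℂ) Matrix.frobeniusNormedAddCommGroup Matrix.frobeniusNormedSpace e * (2 * Real.sqrt (Fintype.card mm)) * (Real.sqrt (Fintype.card mm) * (((1 + ((((L ^ r * L ^ kk : ℕ) : ℝ))⁻¹) * ((C / ξ) * Real.exp (((((L ^ r * L ^ kk : ℕ) : ℝ))⁻¹) * (C / ξ)))) ^ (L ^ r) - 1) / ((((L ^ kk : ℕ) : ℝ))⁻¹)))) + (((L ^ kk : ℕ) : ℝ) * (@basisConst ι _ (Matrix mm mm ℂ) Matrix.frobeniusNormedAddCommGroup Matrix.frobeniusNormedSpace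 e * (2 * Real.sqrt (Fintype.card mm)) * (Real.sqrt (Fintype.card mm) * ((1 + ((((L ^ r * L ^ kk : ℕ) : ℝ))⁻¹) * (((1 + ((((L ^ r * L ^ kk : ℕ) : ℝ))⁻¹) * ((C / ξ) * Real.exp (((((L ^ r * L ^ kk : ℕ) : ℝ))⁻¹) * (C / ξ)))) ^ (L ^ r) - 1) / ((((L ^ kk : ℕ) : ℝ))⁻¹))) ^ (L ^ r) - 1))))))))) ((@basisConst ι _ (Matrix mm mm ℂ) Matrix.frobeniusNormedAddCommGroup Matrix.frobeniusNormedSpace e * (2 * Real.sqrt (Fintype.card mm)) * (Real.sqrt (Fintype.card mm) * ((d + 1) * (d * ((((L ^ r * L ^ kk : ℕ) : ℝ)) * (((L ^ r : ℕ) : ℝ) * (((((L ^ r * L ^ kk : ℕ) : ℝ))⁻¹) ^ 2 * ((C / ξ ^ 2) * Real.exp (((((L ^ r * L ^ kk : ℕ) : ℝ))⁻¹) * (C / ξ)))))) + ((1 + (((((L ^ r * L ^ kk : ℕ) : ℝ))⁻¹) * ((C / ξ) * Real.exp (((((L ^ r * L ^ kk : ℕ) : ℝ))⁻¹) * (C /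 ξ))))) ^ (L ^ r) - 1)))))) ((aK a₀ (L : ℝ) kk)) ((aK a₀ (L : ℝ) (r + kk))) ((Fintype.card ι * (|aK a₀ (L : ℝ) (r + kk) - aK a₀ (L : ℝ) kk| * (1 + Fintype.card ι) + |aK a₀ (L : ℝ) kk| * (2 * Fintype.card ι * (@basisConst ι _ (Matrix mm mm ℂ) Matrix.frobeniusNormedAddCommGroup Matrix.frobeniusNormedSpace e * (2 * Real.sqrt (Fintype.card mm)) * (Real.sqrt (Fintype.card mm) * ((d + 1) * (d * ((((L ^ r * L ^ kk : ℕ) : ℝ)) * (((L ^ r : ℕ) : ℝ) * (((((L ^ r * L ^ kk : ℕ) : ℝ))⁻¹) ^ 2 * ((C / ξ ^ 2) * Real.exp (((((L ^ r * L ^ kk : ℕ) : ℝ))⁻¹) * (C / ξ)))))) + ((1 + (((((L ^ r * L ^ kk : ℕ) : ℝ))⁻¹) * ((C / ξ) * Real.exp (((((L ^ r * L ^ kk : ℕ) : ℝ))⁻¹) * (C / ξ))))) ^ (L ^ r) - 1))))))))) ((Fintype.card ι * (@basisConst ι _ (Matrix mm mm ℂ) Matrix.frobeniusNormedAddCommGroup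 Matrix.frobeniusNormedSpace e * (2 * Real.sqrt (Fintype.card mm)) * (Real.sqrt (Fintype.card mm) * (((1 + ((((L ^ r * L ^ kk : ℕ) : ℝ))⁻¹) * ((C / ξ) * Real.exp (((((L ^ r * L ^ kk : ℕ) : ℝ))⁻¹) * (C / ξ)))) ^ (L ^ r) - 1) / ((((L ^ kk : ℕ) : ℝ))⁻¹)))) + Fintype.card ι * (Fintype.card (Fin (d + 1)) * (Fintype.card ι * (@basisConst ι _ (Matrix mm mm ℂ) Matrix.frobeniusNormedAddCommGroup Matrix.frobeniusNormedSpace e * (2 * Real.sqrt (Fintype.card mm)) * (Real.sqrt (Fintype.card mm) * (((1 + ((((L ^ r * L ^ kk : ℕ) : ℝ))⁻¹) * ((C / ξ) * Real.exp (((((L ^ r * L ^ kk : ℕ) : ℝ))⁻¹) * (C / ξ)))) ^ (L ^ r) - 1) / ((((L ^ kk : ℕ) : ℝ))⁻¹)))) ^ 2 + (@basisConst ι _ (Matrix mm mm ℂ) Matrix.frobeniusNormedAddCommGroup Matrix.frobeniusNormedSpace e * (2 * Real.sqrt (Fintype.card mm)) * (Real.sqrt (Fintype.card mm) * (((C / ξ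 ^ 2) * Real.exp (((((L ^ r * L ^ kk : ℕ) : ℝ))⁻¹) * (C / ξ))) * (1 + ((((L ^ r * L ^ kk : ℕ) : ℝ))⁻¹) * ((C / ξ) * Real.exp (((((L ^ r * L ^ kk : ℕ) : ℝ))⁻¹) * (C / ξ)))) ^ (L ^ r)))))))) (((1 + (Fintype.card ι * (@basisConst ι _ (Matrix mm mm ℂ) Matrix.frobeniusNormedAddCommGroup Matrix.frobeniusNormedSpace e * (2 * Real.sqrt (Fintype.card mm)) * (Real.sqrt (Fintype.card mm) * (((1 + ((((L ^ r * L ^ kk : ℕ) : ℝ))⁻¹) * ((C / ξ) * Real.exp (((((L ^ r * L ^ kk : ℕ) : ℝ))⁻¹) * (C / ξ)))) ^ (L ^ r) - 1) / ((((L ^ kk : ℕ) : ℝ))⁻¹)))) + Fintype.card ι * (Fintype.card (Fin (d + 1)) * (Fintype.card ι * (@basisConst ι _ (Matrix mm mm ℂ) Matrix.frobeniusNormedAddCommGroup Matrix.frobeniusNormedSpace e * (2 * Real.sqrt (Fintype.card mm)) * (Real.sqrt (Fintype.card mm) * (((1 + ((((L ^ r * L ^ kk : ℕ) : ℝ))⁻¹)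 * ((C / ξ) * Real.exp (((((L ^ r * L ^ kk : ℕ) : ℝ))⁻¹) * (C / ξ)))) ^ (L ^ r) - 1) / ((((L ^ kk : ℕ) : ℝ))⁻¹)))) ^ 2 + (@basisConst ι _ (Matrix mm mm ℂ) Matrix.frobeniusNormedAddCommGroup Matrix.frobeniusNormedSpace e * (2 * Real.sqrt (Fintype.card mm)) * (Real.sqrt (Fintype.card mm) * (((C / ξ ^ 2) * Real.exp (((((L ^ r * L ^ kk : ℕ) : ℝ))⁻¹) * (C / ξ))) * (1 + ((((L ^ r * L ^ kk : ℕ) : ℝ))⁻¹) * ((C / ξ) * Real.exp (((((L ^ r * L ^ kk : ℕ) : ℝ))⁻¹) * (C / ξ)))) ^ (L ^ r))))))) * ((((L ^ kk : ℕ) : ℝ))⁻¹)) ^ ((d + 1) * L ^ kk) - 1)) (((1 + (Fintype.card ι * (@basisConst ι _ (Matrix mm mm ℂ) Matrix.frobeniusNormedAddCommGroup Matrix.frobeniusNormedSpace e * (2 * Real.sqrt (Fintype.card mm)) * (Real.sqrt (Fintype.card mm) * (((1 + ((((L ^ r * L ^ kk : ℕ) : ℝ))⁻¹) * ((C / ξ)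 * Real.exp (((((L ^ r * L ^ kk : ℕ) : ℝ))⁻¹) * (C / ξ)))) ^ (L ^ r) - 1) / ((((L ^ kk : ℕ) : ℝ))⁻¹)))) + Fintype.card ι * (Fintype.card (Fin (d + 1)) * (Fintype.card ι * (@basisConst ι _ (Matrix mm mm ℂ) Matrix.frobeniusNormedAddCommGroup Matrix.frobeniusNormedSpace e * (2 * Real.sqrt (Fintype.card mm)) * (Real.sqrt (Fintype.card mm) * (((1 + ((((L ^ r * L ^ kk : ℕ) : ℝ))⁻¹) * ((C / ξ) * Real.exp (((((L ^ r * L ^ kk : ℕ) : ℝ))⁻¹) * (C / ξ)))) ^ (L ^ r) - 1) / ((((L ^ kk : ℕ) : ℝ))⁻¹)))) ^ 2 + (@basisConst ι _ (Matrix mm mm ℂ) Matrix.frobeniusNormedAddCommGroup Matrix.frobeniusNormedSpace e * (2 * Real.sqrt (Fintype.card mm)) * (Real.sqrt (Fintype.card mm) * (((C / ξ ^ 2) * Real.exp (((((L ^ r * L ^ kk : ℕ) : ℝ))⁻¹) * (C / ξ))) * (1 + ((((L ^ r * L ^ kk : ℕ) : ℝ))⁻¹) * ((C / ξ) * Real.exp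 (((((L ^ r * L ^ kk : ℕ) : ℝ))⁻¹) * (C / ξ)))) ^ (L ^ r))))))) * ((((L ^ r * L ^ kk : ℕ) : ℝ))⁻¹)) ^ ((d + 1) * (L ^ r * L ^ kk)) - 1)) (((1 + (Fintype.card ι * (((((L ^ r * L ^ kk : ℕ) : ℝ))⁻¹) * (@basisConst ι _ (Matrix mm mm ℂ) Matrix.frobeniusNormedAddCommGroup Matrix.frobeniusNormedSpace e * (2 * Real.sqrt (Fintype.card mm)) * (Real.sqrt (Fintype.card mm) * (((1 + ((((L ^ r * L ^ kk : ℕ) : ℝ))⁻¹) * ((C / ξ) * Real.exp (((((L ^ r * L ^ kk : ℕ) : ℝ))⁻¹) * (C / ξ)))) ^ (L ^ r) - 1) / ((((L ^ kk : ℕ) : ℝ))⁻¹))))))) ^ ((d + 1) * (L ^ r - 1)) - 1)) ((((L : ℝ) ^ kk) ^ (-(1 / 4 : ℝ)))) ((((L : ℝ) ^ (2 * kk))⁻¹)) oB a₀ R₀ K₁ K₂ c₀ KI Aη Bc KB D (Real.exp (-(δ / 16 * (unitTorusGeo L kk (cvM d L mv kk hL)).dist y y')))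
    (L ^ r) ((d + 1) * L ^ kk) ((d + 1) * (L ^ r * L ^ kk)) ((d + 1) * (L ^ r - 1))
    hI0 hdd0 (by push_cast; ring) (by simp) (by simp [Fintype.card_sum]; ring) ha₀ hK₁ hK₂ hc₀pos hc₀a hc₀b hKI hAη hBc hKB
    hLk1 hLr1 (by rw [Nat.cast_mul]) (by rw [Nat.cast_sub (Nat.one_le_pow _ _ hLpos), Nat.cast_one]) rfl rfl
    rfl (by push_cast; ring) (by push_cast; ring) (by rw [Nat.cast_mul, Nat.cast_sub (Nat.one_le_pow _ _ hLpos)]; push_cast; ring)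
    (by positivity) (Real.sqrt_nonneg _) (by positivity) (by positivity) hsmall rfl rfl rfl rfl rfl rfl rfl rfl rfl rfl rfl rfl rfl rfl rfl
    (by rw [abs_of_pos (aK_pos ha₀ hL1r hk)]; exact aK_le ha₀ hL1r hk) (abs_aK_sub_aK_le ha₀ hL2r hk r) rfl rfl rfl rfl rfl (by positivity)
    (by rw [Nat.cast_pow]; exact (inv_le_rpow_neg_quarter hx1).1) (by rw [mul_comm, pow_mul]; exact (inv_le_rpow_neg_quarter hx1).2) hoB (Real.exp_pos _)
  have hmain := H1 (key (0 : Tor (cvM d L mv kk hL)) 0).1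
  exact hmain.mono fun y y' => (key y y').2

set_option maxHeartbeats 800000 in
/-- ★★★ `uN_idef_covD_scGreenOp_of_reg335Holder_small` at `o_B := o_B^{H,expl}` (n15-c∕391's `_explicit` for the gradient entry). [cite: Balaban1985BackgroundPropagators, (3.42) p.397, (3.35) p.396, (3.51)–(3.52) p.400 (shapes); King1986, p.664 (pairing)] -/
theorem uN_idef_covD_scGreenOp_of_reg335Holder_small_explicit (hL : Odd L ∧ 1 < L) (hL7 : 7 ≤ L) {a₀ : ℝ} (ha₀ : 0 < a₀) (ι : Type) [Fintype ι] [DecidableEq ι] (μ₀ : Fin (d + 1)) :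
    ∃ δ w₀ c₀ D : ℝ, 0 < δ ∧ 0 < c₀ ∧ ∀ (mv kk r : ℕ), 1 ≤ kk → 1 ≤ r → w₀ ≤ ((L ^ mv : ℕ) : ℝ) →
      ∀ {mm : Type} [Fintype mm] [DecidableEq mm] [Nonempty mm] (e : Matrix mm mm ℂ ≃L[ℝ] (ι → ℝ)), (∀ A B : Matrix mm mm ℂ, traceForm A B = e A ⬝ᵥ e B) →
      ∀ (U' : Fin (d + 1) → ScX' d L mv kk r hL → (Matrix mm mm ℂ)ˣ), (∀ μ x', (U' μ x' : Matrix mm mm ℂ) ∈ Matrix.unitaryGroup mm ℂ) →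
      ∀ (Q : (Fin (d + 1) → ZMod (2 * L)) → Set (ScX' d L mv kk r hL)) (ξ C β Cβ : ℝ), 0 < ξ → 0 ≤ C → 0 ≤ β → 0 ≤ Cβ →
        (1 + @basisConst ι _ (Matrix mm mm ℂ) Matrix.frobeniusNormedAddCommGroup Matrix.frobeniusNormedSpace e * (2 * Real.sqrt (Fintype.card mm)) * Real.sqrt (Fintype.card mm)) ^ 2 * (C / ξ + C / ξ ^ 2) ≤ c₀ →
        (∀ k, Reg335HolderCube (scShift' d L mv kk r hL) U' ((((L ^ r * L ^ kk : ℕ) : ℝ))⁻¹) (Q k) ξ (fun z z' => ((((L ^ r * L ^ kk : ℕ) : ℝ))⁻¹) * tdistT (fine (L ^ r * L ^ kk) (cvM d L mv kk hL)) z z') C β Cβ) →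
        (∀ k z, (∃ y ∈ cvSk d L mv kk hL k, (unitTorusGeo L kk (cvM d L mv kk hL)).dist (scBlk' d L mv kk r hL z) y ≤ 5) → z ∈ Q k) →
        HasMaj (ScNorm d L mv kk hL ι) (BlockNorm.ofBlocks (unitTorusGeo L kk (cvM d L mv kk hL)) (liftBlk (scBlk d L mv kk hL ∘ kingPr L kk r (cvM d L mv kk hL)) ι))
          (idef (ctauS (cvM d L mv kk hL) L kk r (fun μ x' => coordMat e (ContinuousLinearMap.mulLeftRight ℝ (Matrix mm mm ℂ) ((U' μ x' : Matrix mm mm ℂ)) ((U' μ x' : Matrix mm mm ℂ))ᴴ))) (ctauS (cvM d L mv kk hL) L kk r (fun μ x' => coordMat e (ContinuousLinearMap.mulLeftRight ℝ (Matrix mm mm ℂ) ((U' μ x' : Matrix mm mm ℂ)) ((U' μ x' : Matrix mm mm ℂ))ᴴ))) (covD ((((L ^ r * L ^ kk : ℕ) : ℝ))⁻¹) (fun x' => coordMat e (ContinuousLinearMap.mulLeftRight ℝ (Matrix mm mm ℂ) ((U' μ₀ x' : Matrix mm mm ℂ)) ((U' μ₀ x' : Matrix mm mm ℂ))ᴴ))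 (scShift' d L mv kk r hL μ₀) ∘ₗ scGreenOp' d L mv kk r hL (aK a₀ (L : ℝ) (r + kk) * (((L ^ r * L ^ kk : ℕ) : ℝ)) ^ (d + 1)) ((((L ^ r * L ^ kk : ℕ) : ℝ))⁻¹) ι e (fun μ z => (U' μ z : Matrix mm mm ℂ))) (covD ((((L ^ kk : ℕ) : ℝ))⁻¹) (fun x => coordMat e (ContinuousLinearMap.mulLeftRight ℝ (Matrix mm mm ℂ) ((fun μ y => mprod (fun t => (U' μ (kingSec (cvM d L mv kk hL) L kk r y + t • unitVec (fine (L ^ r * L ^ kk) (cvM d L mv kk hL)) μ) : Matrix mm mm ℂ)) (L ^ r)) μ₀ x) ((fun μ y => mprod (fun t => (U' μ (kingSec (cvM d L mv kk hL) L kk r y + t • unitVec (fine (L ^ r * L ^ kk) (cvM d L mv kk hL)) μ) : Matrix mm mm ℂ)) (L ^ r)) μ₀ x)ᴴ)) (scShift d L mv kk hL μ₀) ∘ₗ scGreenOp d L mv kk hL (aK a₀ (L : ℝ) kk * (((L ^ kk : ℕ) : ℝ)) ^ (d + 1)) ((((L ^ kk : ℕ) : ℝ))⁻¹) ι e (fun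 μ y => mprod (fun t => (U' μ (kingSec (cvM d L mv kk hL) L kk r y + t • unitVec (fine (L ^ r * L ^ kk) (cvM d L mv kk hL)) μ) : Matrix mm mm ℂ)) (L ^ r))))
          (fun y y' => D * (((L : ℝ) ^ kk) ^ (-(1 / 4 : ℝ)) + (@basisConst ι _ (Matrix mm mm ℂ) Matrix.frobeniusNormedAddCommGroup Matrix.frobeniusNormedSpace e * (((L ^ r * L ^ kk : ℕ) : ℝ) ^ 2 * (Fintype.card mm * (2 * (((((L ^ r * L ^ kk : ℕ) : ℝ))⁻¹) ^ 2 * ((Cβ * (ξ ^ (2 + β))⁻¹ * (2 * ((L ^ r : ℕ) : ℝ) * ((((L ^ r * L ^ kk : ℕ) : ℝ))⁻¹)) ^ β + 2 * ((((L ^ r * L ^ kk : ℕ) : ℝ))⁻¹) * ((C / ξ) * (C / ξ ^ 2))) * Real.exp (5 * (((((L ^ r * L ^ kk : ℕ) : ℝ))⁻¹) * (C / ξ))))) + ((((L ^ r * L ^ kk : ℕ) : ℝ))⁻¹) ^ 2 * ((C / ξ ^ 2) * Real.exp (((((L ^ r * L ^ kk : ℕ) : ℝ))⁻¹) * (C /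 ξ))) * (((d + 1 : ℕ) : ℝ) * (((L ^ r - 1 : ℕ) : ℝ) * (((((L ^ r * L ^ kk : ℕ) : ℝ))⁻¹) ^ 2 * ((C / ξ ^ 2) * Real.exp (((((L ^ r * L ^ kk : ℕ) : ℝ))⁻¹) * (C / ξ)))))) + (((((L ^ r * L ^ kk : ℕ) : ℝ))⁻¹) ^ 2 * ((C / ξ ^ 2) * Real.exp (((((L ^ r * L ^ kk : ℕ) : ℝ))⁻¹) * (C / ξ))) + (((d + 1 : ℕ) : ℝ) * (((L ^ r - 1 : ℕ) : ℝ) * (((((L ^ r * L ^ kk : ℕ) : ℝ))⁻¹) ^ 2 * ((C / ξ ^ 2) * Real.exp (((((L ^ r * L ^ kk : ℕ) : ℝ))⁻¹) * (C / ξ)))))) + ((((L ^ r * L ^ kk : ℕ) : ℝ))⁻¹) ^ 2 * ((C / ξ ^ 2) * Real.exp (((((L ^ r * L ^ kk : ℕ) : ℝ))⁻¹) * (C / ξ)))) * (((((L ^ r * L ^ kk : ℕ) : ℝ))⁻¹) ^ 2 * ((C / ξ ^ 2) * Real.exp (((((L ^ r * L ^ kk : ℕ) : ℝ))⁻¹)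 * (C / ξ)))))) + Fintype.card mm * (2 * ((L ^ kk : ℕ) : ℝ) ^ 2 * (2 * ((L ^ r : ℕ) : ℝ) ^ 3 * ((((((L ^ r * L ^ kk : ℕ) : ℝ))⁻¹) * ((C / ξ) * Real.exp (((((L ^ r * L ^ kk : ℕ) : ℝ))⁻¹) * (C / ξ)))) * (((((L ^ r * L ^ kk : ℕ) : ℝ))⁻¹) ^ 2 * ((C / ξ ^ 2) * Real.exp (((((L ^ r * L ^ kk : ℕ) : ℝ))⁻¹) * (C / ξ))))) + ((L ^ r : ℕ) : ℝ) ^ 2 * (((((L ^ r * L ^ kk : ℕ) : ℝ))⁻¹) ^ 2 * ((Cβ * (ξ ^ (2 + β))⁻¹ * (2 * ((L ^ r : ℕ) : ℝ) * ((((L ^ r * L ^ kk : ℕ) : ℝ))⁻¹)) ^ β + 2 * ((((L ^ r * L ^ kk : ℕ) : ℝ))⁻¹) * ((C / ξ) * (C / ξ ^ 2))) * Real.exp (5 * (((((L ^ r * L ^ kk : ℕ) : ℝ))⁻¹) * (C / ξ)))))) + 2 * (((L ^ r : ℕ) : ℝ) * ((L ^ kk : ℕ) : ℝ)) ^ 2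 * ((((L ^ r : ℕ) : ℝ) + 1) * (((((L ^ r * L ^ kk : ℕ) : ℝ))⁻¹) * ((C / ξ) * Real.exp (((((L ^ r * L ^ kk : ℕ) : ℝ))⁻¹) * (C / ξ)))) * (((((L ^ r * L ^ kk : ℕ) : ℝ))⁻¹) ^ 2 * ((C / ξ ^ 2) * Real.exp (((((L ^ r * L ^ kk : ℕ) : ℝ))⁻¹) * (C / ξ))))))))) * Real.exp (-(δ / 16 * (unitTorusGeo L kk (cvM d L mv kk hL)).dist y y'))) := by
  obtain ⟨δ, w₀, c₀, D, hδ, hc₀, H⟩ := uN_idef_covD_scGreenOp_of_reg335Holder_small (d := d) hL hL7 ha₀ ι μ₀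
  refine ⟨δ, w₀, c₀, D, hδ, hc₀, fun mv kk r hk hr hw₀ => ?_⟩
  intro mm _ _ _ e he U' hU'g Q ξ C β Cβ hξ hC hβ hCβ hsmall h335 hQ
  have hκ := @basisConst_nonneg ι _ (Matrix mm mm ℂ) Matrix.frobeniusNormedAddCommGroup Matrix.frobeniusNormedSpace e
  exact H mv kk r hk hr hw₀ e he U' hU'g Q ξ C β Cβ hξ hC hβ hCβ hsmall h335 hQ _ (by positivity) le_rfl

end Small

end Summit.QuantumFields.YangMills.BalabanUVNodes.N15.Gluing

end
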